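import Literature.Geometry.Riemannian.CylinderChartComponents
import HarnessLib

/-!
# The deformed generalized cylinder read in a chart (Bär–Hanke 2023, §3, Thm. 27)

Topic `Literature/Geometry/Riemannian`. A brick (K5a of the notes) of the proof of the named fact
`Literature.Geometry.Riemannian.BarHanke2023_thm27_umbilicNormalForm`. For the deformed cylinder
`G'` of `CylinderNormalFormMetric.lean`,

  `G'_{(z,t)}(v,w) = (1 − a t) G_{(z,t)}(v,w) + a t (P_t(z)(v₁,w₁) + v₂w₂)`,
  `P_t = (1 − (Ct² + 2μχ(t))) g₀ + (t − χ(t)) B`,   `B = ġ₀`,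

the slice components `F'(y, s)` in a chart `ψ` of `N` (`CylinderChartComponents.lean`) are the
corresponding combination of the slice components `F(y, s)` of `G`, of `F(y, 0)` and of the
initial velocity `Ḟ(y, 0)`:

* `normalFormComponents_eq` —
  `F'(p, s) = (1 − a s) F(p, s) + a s (1 − (C s² + 2 μ(ψ⁻¹p) χ s)) F(p, 0) + a s (s − χ s) Ḟ(p, 0)`
  (the components of `B = ġ₀` are `Ḟ(·, 0)`: `hasDerivAt_cylComponents_apply₂` and uniqueness of
  derivatives).

This is the dictionary through which the pointwise estimates `MetricCoord.stepA_pointwise`,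
`MetricCoord.stepB_pointwise` are applied to `G'`. Everything is proved; no definitions, no named
facts (D-0026).

## References

* C. Bär, B. Hanke, *Boundary conditions for scalar curvature*, arXiv:2012.09127, §3, (7)–(8),
  Prop. 23, (15), Thm. 27. [BarHanke2023]
-/

noncomputable section

set_option maxSynthPendingDepth 3

open Bundle Set Filter Function Metric TopologicalSpace
open scoped Manifold ContDiff Topology

namespace Literature.Geometry.Riemannian

open Literature.Geometry.Lorentzian
open Literature.Geometry.Lorentzian.PseudoRiemannianMetric

variable {E' : Type*} [NormedAddCommGroup E'] [NormedSpace ℝ E'] [FiniteDimensional ℝ E']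
  {N : Type*} [TopologicalSpace N] [ChartedSpace E' N] [IsManifold 𝓘(ℝ, E') ∞ N]
  (G G' : PseudoRiemannianMetric (𝓘(ℝ, E').prod 𝓘(ℝ, ℝ)) ∞ (E' × ℝ)
    (TangentSpace (𝓘(ℝ, E').prod 𝓘(ℝ, ℝ)) : N × ℝ → Type _))
  {ψ : OpenPartialHomeomorph N E'}
  (hG : G.IsRiemannian) (hG' : G'.IsRiemannian)
  (hψ : ψ ∈ IsManifold.maximalAtlas 𝓘(ℝ, E') ∞ N)
  (F : E' → ℝ → E' →L[ℝ] E' →L[ℝ] ℝ)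
  (hF : ∀ (y : E') (s : ℝ), F y s = MaxAtlasChart.metricRepr
    (G.inducedMetric (fun x : N ↦ ((x, s) : N × ℝ))
      (contMDiff_pullbackBilin_holds (I := 𝓘(ℝ, E').prod 𝓘(ℝ, ℝ)) (M := N × ℝ)
        (I' := 𝓘(ℝ, E')) (N := N))
      (isSpacelikeImmersion_cylSlice G hG s)) hψ y)
  (F' : E' → ℝ → E' →L[ℝ] E' →L[ℝ] ℝ)
  (hF' : ∀ (y : E') (s : ℝ), F' y s = MaxAtlasChart.metricRepr
    (G'.inducedMetric (fun x : N ↦ ((x, s) : N × ℝ))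
      (contMDiff_pullbackBilin_holds (I := 𝓘(ℝ, E').prod 𝓘(ℝ, ℝ)) (M := N × ℝ)
        (I' := 𝓘(ℝ, E')) (N := N))
      (isSpacelikeImmersion_cylSlice G' hG' s)) hψ y)

include hF hF'

/-- **The components of the deformed cylinder.** If
`G'_{(z,t)}(v,w) = (1 − a t) G_{(z,t)}(v,w) + a t ((1 − (Ct² + 2μ(z)χ(t))) g₀(z)(v₁,w₁) + (t − χ t) B(z)(v₁,w₁) + v₂w₂)`
with `B = ġ₀` (`∂_t|₀ G_{(z,t)}((v,0),(w,0)) = B(z)(v,w)`), then in every chart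
`F'(p, s) = (1 − a s) F(p, s) + a s (1 − (C s² + 2 μ(ψ⁻¹p) χ s)) F(p, 0) + a s (s − χ s) Ḟ(p, 0)`.
[cite: BarHanke2023, §3, (7)–(8) and Prop. 23, (15)] -/
theorem normalFormComponents_eq
    {B : Π z : N, TangentSpace 𝓘(ℝ, E') z →L[ℝ] TangentSpace 𝓘(ℝ, E') z →L[ℝ] ℝ}
    {μ : N → ℝ} {a χ : ℝ → ℝ} {C : ℝ}
    (hval : ∀ (z : N) (t : ℝ) (v w : TangentSpace (𝓘(ℝ, E').prod 𝓘(ℝ, ℝ)) (z, t)),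
      G'.val (z, t) v w = (1 - a t) * G.val (z, t) v w +
        a t * ((1 - (C * t ^ 2 + 2 * μ z * χ t)) *
            G.val (z, (0 : ℝ)) ((v.1, 0) : TangentSpace (𝓘(ℝ, E').prod 𝓘(ℝ, ℝ)) (z, (0 : ℝ)))
              ((w.1, 0) : TangentSpace (𝓘(ℝ, E').prod 𝓘(ℝ, ℝ)) (z, (0 : ℝ))) +
          (t - χ t) * B z v.1 w.1 + v.2 * w.2))
    (hBd : ∀ (z : N) (v w : E'),
      HasDerivAt (fun t : ℝ ↦ G.val (z, t) ((v, 0) : TangentSpace (𝓘(ℝ, E').prod 𝓘(ℝ, ℝ)) (z, t))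
        ((w, 0) : TangentSpace (𝓘(ℝ, E').prod 𝓘(ℝ, ℝ)) (z, t))) (B z v w) 0)
    (p : MaxAtlasChart.target ψ) (s : ℝ) :
    F' p s = (1 - a s) • F p s +
      (a s * (1 - (C * s ^ 2 + 2 * μ (ψ.symm p) * χ s))) • F p 0 +
      (a s * (s - χ s)) • deriv (fun σ : ℝ ↦ F p σ) 0 := by
  ext u u'
  -- the components of `B` are `Ḟ(·, 0)`
  have hB : B (ψ.symm p) (mfderiv 𝓘(ℝ, E') 𝓘(ℝ, E') ψ.symm (p : E') u)
      (mfderiv 𝓘(ℝ, E') 𝓘(ℝ, E') ψ.symm (p : E') u') = deriv (fun σ : ℝ ↦ F p σ) 0 u u' := by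
    have h1 := hBd (ψ.symm p) (mfderiv 𝓘(ℝ, E') 𝓘(ℝ, E') ψ.symm (p : E') u)
      (mfderiv 𝓘(ℝ, E') 𝓘(ℝ, E') ψ.symm (p : E') u')
    have h2 := hasDerivAt_cylComponents_apply₂ G hG hψ F hF p 0 u u'
    have hfun : (fun σ : ℝ ↦ F p σ u u') = fun σ : ℝ ↦ G.val (ψ.symm p, σ)
        ((mfderiv 𝓘(ℝ, E') 𝓘(ℝ, E') ψ.symm (p : E') u, 0) :
          TangentSpace (𝓘(ℝ, E').prod 𝓘(ℝ, ℝ)) (ψ.symm p, σ))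
        ((mfderiv 𝓘(ℝ, E') 𝓘(ℝ, E') ψ.symm (p : E') u', 0) :
          TangentSpace (𝓘(ℝ, E').prod 𝓘(ℝ, ℝ)) (ψ.symm p, σ)) :=
      funext fun σ ↦ cylComponents_apply G hG hψ F hF p σ u u'
    rw [hfun] at h2
    exact h1.unique h2
  have e1 := cylComponents_apply G hG hψ F hF p s u u'
  have e0 := cylComponents_apply G hG hψ F hF p 0 u u'
  rw [cylComponents_apply G' hG' hψ F' hF' p s u u', hval]
  simp only [_root_.add_apply, _root_.smul_apply, smul_eq_mul]
  rw [e1, e0, ← hB]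
  ring

end Literature.Geometry.Riemannian

end
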